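import Summits.QuantumFields.BalabanUV.Beta.FP.GhostGaugeLaw
import Summits.QuantumFields.BalabanUV.Beta.FP.GhostCubicGerm
import Summits.QuantumFields.BalabanUV.Beta.D1BFx.GhostStencilWard

/-!
# `BalabanUV.Beta.FP.GhostBiTableLaw` — road «FP» for binder row D1, PART 3b row #2 (H2V-4 ghost letters), the (a8g) letter: THE SECOND-ORDER
# GHOST WARD LAW HOLDS FOR THE EXPLICIT CROSS CONTACT `−ghX`, UNIQUELY AMONG BOND-DIAGONAL TABLES; THE HEAD CONTACT `Wgh` FAILS FOR EVERY WEIGHT;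
# with it ALL TEN ghost binders of the H2V-4 block are theorems at the explicit triple `(ghCur, diagExt (−ghX), −projU)`

HONEST DEPENDENCY (page 1, mandatory): continuum YM on T⁴ ⇐ BetaPertH ∧ nine spine estimates (0/9 proved); BetaPertH ⇐ (D1) ∧ (D4) ∧
CAP+tail; G-an2-4 gates asym, D1 and NE2/3/4.  HONEST FRAMING (cell contract, verbatim): «discharging `BetaPertH` makes Bałaban's UV
stability UNCONDITIONAL — a real constructive-QFT result; it is NOT the continuum limit and NOT the Clay problem.»  THIS MODULE is [folklore] finite
stencil algebra about the road's OWN typed objects (`D1BFx.GhostStencil.ghCur`∕`ghCnt`∕`Wgh`, `D1BFx.GhostStencilReflection.ghX`,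
`D1BFx.GhostStencilWard.genX`, `FP.PerfectPolarizationWardLetters.projU`, an2's `KernelWard.divW`); no `def`, no `def … : Prop`, nothing cited, nothing of
the manuscripts under audit asserted, 0 sorry; no existing file touched.  It DISCHARGES NO ESTIMATE and 0∕4 row-D1 binders.  NOT H2V-4 row #1 (gluon side),
NOT `hKcov`, NOT (ASYMP), NOT D1, NOT BetaPertH, NOT continuum, NOT Clay.  «not in print; our bookkeeping».

ABSOLUTE RULE (cell charter, verbatim): «No internally-minted statement may enter as a cited fact. Every hypothesis is either kernel-proved in this
package or a verbatim quotation of a PUBLISHED theorem with page reference. The manuscript(s) under audit are NOT citable for their own disputed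
steps — they are the thing under adjudication; programme-internal (2001/route/tribunal) claims are never citable.»

WHY.  Every END of road FP (`RoadLeftAssemblyRows.d1Drift_left_of_sliceLedger_rows`, `RoadLeftAssemblyLetters.…_rows_letters`, the literal instances) displays
the H2V-4 GHOST block `hv hw hcovv hcovw hXg hW1g hW2g h0v hgermv hwloc` over abstract data `(v, w, Xg)`.  At `(v, Xg) := (ghCur, −projU)` six of them are tree
theorems (`GhostCubicGerm.ghost_letters`, `GhostGaugeLaw.w1_ghCur`, `PerfectPolarizationWardLetters.biLoc_projU`); the four `w`-letters were open because the
typed candidate `GhostStencil.Wgh cW` (HEAD contact `[x = z = u + e_κ]`) violates (a8g) (`GhostGaugeLaw` header; road BF-x's `GhostStencilWard.cW_eq_zero_of_W2`).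
This file supplies them at the reversal-symmetric CROSS contact `ghX κ u x z = [x = u + e_κ ∧ z = u] + [x = u ∧ z = u + e_κ]` with coefficient `−1`.

CONTENT.
* §1 [folklore] bridges: `projU_eq_genX` (the two colour-stripped site generators of the tree agree), `Wgh_eq_diagExt` (`Wgh cW = diagExt (ghTab cW)`),
  `smul_shiftK`.
* §2 [folklore] THE FOUR `w`-LETTERS at `w := diagExt (fun κ u ↦ c • ghX κ u)`: **`hW2g_ghX`** (the (a8g) law, `c = −1`: VERBATIM the binder `hW2g` at
  `(v, Xg) := (ghCur, fun y ↦ (−1) • projU y)` — road BF-x's `GhostStencilWard.ward₂_ghX` read at `Sgh n cK 0 = cK • ghCur`, `cK := −1`), **`hw_ghX`** (bi-localisation at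
  the two bonds, constant `|c|·e^{δ}`, every real `δ`), **`hcovw_ghX`** (translation covariance), **`hwloc_ghX`** (the `(0, z)`-letter: off the diagonal bond the table is `0`),
  and `hXg_projU` (`BiLoc ((−1) • projU y) y y 1 δ`).
* §3 LOCATED [our object]: **`eq_neg_ghX_of_hW2g`** — a bond-DIAGONAL table `diagExt T` satisfying (a8g) against `(ghCur, −projU)` IS `T = fun κ u ↦ (−1) • ghX κ u`
  (read the law at `y = y′`); **`not_hW2g_Wgh`** — `Wgh cW` satisfies (a8g) for NO weight `cW` (by §3's uniqueness at the entry `(u, u + e_0)`).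
* §4 [our object] **`ghost_sector_letters`** — ALL TEN ghost binders of PART 3b row #2, in the END's binder ORDER and SHAPES, at the explicit triple
  `(v, w, Xg) := (ghCur, diagExt (fun κ u ↦ (−1) • ghX κ u), fun y ↦ (−1) • projU y)` with `Cv = Cw′ = CwL′ := e^{δ}`, `Cx′ := 1` (any real `δ`).
READING (prose; nothing asserted about the manuscripts): for the lattice covariant Laplacian `D_U^* D_U` on adjoint scalars with `U_b = e^{B_b}` all `B`-dependence sits in
`−2⟨c̄(u), Ad(U_b) c(u + e)⟩`, whose same-bond second jet is the CROSS contact with the current's weight and whose background covariance is exact — the shape (a8g)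
singles out here; the HEAD contact is the second jet of the linear transporter `1 + B_b`, covariant to first order only (road BF-x `GhostStencilWard` header, leaf-01 gen 3).
Which table the literal's ghost sector carries is the owner's identification (CHECK-N0), not this file's.
Provenance: D1 formalisation swarm LEAF PROVER 01, unit `b2b-balaban-beta-d1-formalise-leaf-01` gen 14, 2026-08-21 (INTENT 1, CLAIMS.log l.30041).
-/

noncomputable section

namespace Summit.QuantumFields.BalabanUV.Beta.FP.GhostBiTableLaw

open Finset
open scoped BigOperators
open Literature.MathematicalPhysics.QuantumFieldTheory.Balaban1983to89
open Literature.MathematicalPhysics.QuantumFieldTheory.Balaban1983to89.Beta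
open B12Sec2to5 (l1 l1_nonneg)
open ExpKernelCalculus (MKer Site comp BiLoc shiftK)
open AffineAveraging (unitVec unitVec_apply)
open KernelWard (divV divW)
open Summit.QuantumFields.BalabanUV.Beta.D1BFx.GhostStencil (ghCur ghCur_apply ghCur_translate biLoc_ghCur ghCnt ghCnt_apply Wgh unitVec_ne_zero l1_zero)
open Summit.QuantumFields.BalabanUV.Beta.D1BFx.ReducedKernelSandwichBlock (diagExt diagExt_apply biLoc_diagExt diagExt_translate)
open Summit.QuantumFields.BalabanUV.Beta.D1BFx.GhostKernelSandwich (ghTab ghTab_apply)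
open Summit.QuantumFields.BalabanUV.Beta.D1BFx.GhostStencilReflection (ghX ghX_apply ghX_translate biLoc_ghX add_unitVec_ne_self self_ne_add_unitVec)
open Summit.QuantumFields.BalabanUV.Beta.D1BFx.GhostStencilWard (genX genX_apply divW_diagExt comm_genX_ghCur ward₂_ghX Sgh_zero_eq comp_smul_right'
  comp_smul_left')
open Summit.QuantumFields.BalabanUV.Beta.FP.PerfectPolarization (G0ker)
open Summit.QuantumFields.BalabanUV.Beta.FP.WardSandwichEngine (projM projM_apply)
open Summit.QuantumFields.BalabanUV.Beta.FP.PerfectPolarizationWardLetters (projU projU_def biLoc_projU biLoc_smul)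
open Summit.QuantumFields.BalabanUV.Beta.FP.GhostGaugeLaw (w1_ghCur)
open Summit.QuantumFields.BalabanUV.Beta.FP.GhostCubicGerm (cubicGermOfSc tsum_ghCur_eq_zero cubicGermOfSc_ghCur)
open Summit.QuantumFields.BalabanUV.Beta.FP.BubbleGermValue (ghostGerm)

/-! ## §1 Bridges -/

/-- [folklore] **THE TWO COLOUR-STRIPPED SITE GENERATORS OF THE TREE AGREE**: `PerfectPolarizationWardLetters.projU y = GhostStencilWard.genX y`
(`[x = y ∧ z = y]`; the fibre is `Unit`, so `projM`'s `a = b` clause is vacuous). -/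
theorem projU_eq_genX (y : Site 4) : projU y = genX y := by
  funext x z a b
  rw [projU_def, projM_apply, genX_apply]
  simp only [and_true]

/-- [folklore] road FP's `Wgh` IS the diagonal extension of road BF-x's head-contact table: `Wgh cW = diagExt (ghTab cW)`. -/
theorem Wgh_eq_diagExt (cW : ℝ) : Wgh cW = diagExt (ghTab cW) := by
  funext κ u l u' x z a b
  rw [diagExt_apply, ghTab_apply]
  rfl

/-- [folklore] scalars commute with fine translation of a kernel. -/
theorem smul_shiftK (c : ℝ) (v : Site 4) (K : MKer 4 Unit) : c • shiftK v K = shiftK v (c • K) := rfl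

/-! ## §2 The four `w`-letters at the cross contact, and the generator's letter -/

/-- [folklore] **(a8g) — THE SECOND-ORDER GHOST WARD LAW FOR THE CROSS CONTACT WITH COEFFICIENT `−1`** (VERBATIM the binder `hW2g` of road FP's ENDs at
`(v, w, Xg) := (ghCur, diagExt (fun κ u ↦ (−1) • ghX κ u), fun y ↦ (−1) • projU y)`): for all `y ν y′`,
`divW (diagExt (fun κ u ↦ (−1) • ghX κ u)) y ν y′ = ((−1) • projU y) ∘ ghCur ν y′ − ghCur ν y′ ∘ ((−1) • projU y)`.
Proof: road BF-x's `GhostStencilWard.ward₂_ghX` (leaf-01 gen 3) read at `Sgh 1 (−1) 0 = (−1) • ghCur`, generators bridged by `projU_eq_genX`. -/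
theorem hW2g_ghX (y : Site 4) (ν : Fin 4) (y' : Site 4) :
    divW (diagExt (fun κ u => (-1 : ℝ) • ghX κ u)) y ν y'
      = comp ((-(1 : ℝ)) • projU y) (ghCur ν y') - comp (ghCur ν y') ((-(1 : ℝ)) • projU y) := by
  rw [ward₂_ghX ν y' 1 (-1) y, Sgh_zero_eq, projU_eq_genX, comp_smul_right', comp_smul_left', comp_smul_right', comp_smul_left']

/-- [folklore] **`hw`**: the diagonal extension of `c • ghX` is bi-localised at its two bonds with constant `|c|·e^{δ}`, every real `δ`. -/
theorem hw_ghX (c δ : ℝ) (μ : Fin 4) (y : Site 4) (ν : Fin 4) (y' : Site 4) :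
    BiLoc (diagExt (fun κ u => c • ghX κ u) μ y ν y') y y' (|c| * Real.exp δ) δ :=
  biLoc_diagExt _ (fun κ u => biLoc_smul (biLoc_ghX κ u δ) c) (by positivity) μ y ν y'

/-- [folklore] **`hcovw`**: fine-translation covariance of the diagonal extension of `c • ghX` (every translation `t`). -/
theorem hcovw_ghX (c : ℝ) (μ : Fin 4) (y : Site 4) (ν : Fin 4) (y' t : Site 4) :
    diagExt (fun κ u => c • ghX κ u) μ (y + t) ν (y' + t) = shiftK (-t) (diagExt (fun κ u => c • ghX κ u) μ y ν y') :=
  diagExt_translate _ (fun s : Site 4 => s) (fun κ u s => by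
    show c • ghX κ (u + s) = shiftK (-s) (c • ghX κ u)
    rw [ghX_translate, smul_shiftK]) μ y ν y' t

/-- [folklore] **`hwloc`**: the `(0, z)`-letter of the END — `BiLoc (w μ 0 ν z) 0 z (CwL′·e^{−δ·|z|₁}) δ` with `CwL′ := |c|·e^{δ}` — for
`w := diagExt (c • ghX)`: off the diagonal bond `(μ, 0) = (ν, z)` the table is `0`, on it `z = 0` and the weight `e^{−δ·|z|₁}` is `1`. -/
theorem hwloc_ghX (c δ : ℝ) (μ ν : Fin 4) (z : Site 4) :
    BiLoc (diagExt (fun κ u => c • ghX κ u) μ 0 ν z) 0 z (|c| * Real.exp δ * Real.exp (-δ * l1 z)) δ := by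
  intro x x' a b
  rw [diagExt_apply]
  split_ifs with h
  · obtain ⟨-, h0⟩ := h
    rw [← h0, l1_zero, mul_zero, Real.exp_zero, mul_one]
    exact biLoc_smul (biLoc_ghX μ 0 δ) c x x' a b
  · rw [abs_zero]
    positivity

/-- [folklore] **`hXg`**: the scaled generator `(−1) • projU y` is bi-localised at `(y, y)` with constant `1`, every real `δ`. -/
theorem hXg_projU (y : Site 4) (δ : ℝ) : BiLoc ((-(1 : ℝ)) • projU y) y y 1 δ := by
  have h := biLoc_smul (biLoc_projU y δ) (-(1 : ℝ))
  rw [abs_neg, abs_one, one_mul, ← projU_def] at h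
  exact h

/-! ## §3 Located: uniqueness among bond-diagonal tables; the head contact fails for every weight -/

/-- [our object] **UNIQUENESS OF THE BOND-DIAGONAL SOLUTION OF (a8g).**  If the diagonal extension of a one-bond table `T` satisfies the second-order
ghost Ward law against `(ghCur, −projU)`, then `T` IS the cross contact with coefficient `−1`.  (Read the law at `y = y′`: its left side is `−T ν y′`
(`y′ ≠ y′ + e_ν`), its right side `−[genX y′, ghCur ν y′] = ghX ν y′`.) -/
theorem eq_neg_ghX_of_hW2g (T : Fin 4 → Site 4 → MKer 4 Unit)
    (h : ∀ (y : Site 4) (ν : Fin 4) (y' : Site 4),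
      divW (diagExt T) y ν y' = comp ((-(1 : ℝ)) • projU y) (ghCur ν y') - comp (ghCur ν y') ((-(1 : ℝ)) • projU y)) :
    T = fun κ u => (-1 : ℝ) • ghX κ u := by
  funext ν u
  have key := h u ν u
  rw [divW_diagExt, if_neg (self_ne_add_unitVec u ν), if_pos rfl, zero_sub, projU_eq_genX, comp_smul_left', comp_smul_right',
    ← smul_sub, comm_genX_ghCur, if_neg (self_ne_add_unitVec u ν), if_pos rfl, smul_smul] at key
  -- key : -T ν u = (-1 * (0 - 1)) • ghX ν u
  have e : T ν u = -((-1 * (0 - 1) : ℝ) • ghX ν u) := by rw [← key, neg_neg]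
  rw [e, ← neg_smul]
  norm_num

/-- [our object] **THE HEAD CONTACT FAILS (a8g) FOR EVERY WEIGHT**: for no real `cW` does `GhostStencil.Wgh cW` (`[same bond]·cW·[x = z = u + e_κ]`)
satisfy the second-order ghost Ward law against `(ghCur, −projU)`.  (By §3's uniqueness `ghTab cW` would be `−ghX`; at the entry `(u, u + e_0)` of the bond
`(0, u)`, `u = 0`, the head contact reads `0` and the cross contact `1`.) -/
theorem not_hW2g_Wgh (cW : ℝ) :
    ¬ ∀ (y : Site 4) (ν : Fin 4) (y' : Site 4),
      divW (Wgh cW) y ν y' = comp ((-(1 : ℝ)) • projU y) (ghCur ν y') - comp (ghCur ν y') ((-(1 : ℝ)) • projU y) := by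
  intro h
  rw [Wgh_eq_diagExt] at h
  have hT := eq_neg_ghX_of_hW2g (ghTab cW) h
  have hne : (unitVec 0 : Site 4) ≠ 0 := unitVec_ne_zero 0
  have e := congr_fun (congr_fun (congr_fun (congr_fun (congr_fun (congr_fun hT 0) 0) 0) (0 + unitVec 0)) ()) ()
  rw [ghTab_apply, Pi.smul_apply, Pi.smul_apply, Pi.smul_apply, Pi.smul_apply, Pi.smul_apply, Pi.smul_apply, Pi.smul_apply, Pi.smul_apply,
    smul_eq_mul, smul_eq_mul, ghCnt_apply, ghX_apply, zero_add] at e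
  rw [if_neg (fun hh => hne hh.1.symm), if_neg (fun hh => hne hh.1.symm), if_pos ⟨rfl, rfl⟩] at e
  norm_num at e

/-! ## §4 The ten ghost binders of PART 3b row #2 at the explicit triple -/

/-- [our object] **THE WHOLE GHOST BLOCK OF H2V-4 AT THE EXPLICIT TRIPLE** `(v, w, Xg) := (ghCur, diagExt (fun κ u ↦ (−1) • ghX κ u), fun y ↦ (−1) • projU y)`,
in the ORDER and SHAPES of road FP's ENDs (`hv hw hcovv hcovw hXg hW1g hW2g h0v hgermv hwloc`), constants `Cv = Cw′ = CwL′ := e^{δ}`, `Cx′ := 1`, any real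
`δ` (the ENDs ask `0 < δ`): six by `GhostCubicGerm.ghost_letters`∕`GhostGaugeLaw.w1_ghCur`∕`hXg_projU`, four by §2.  `hKcov` is NOT here (abstract in the ENDs). -/
theorem ghost_sector_letters (δ : ℝ) :
    (∀ (μ : Fin 4) (y : Site 4), BiLoc (ghCur μ y) y y (Real.exp δ) δ) ∧
    (∀ (μ : Fin 4) (y : Site 4) (ν : Fin 4) (y' : Site 4),
      BiLoc (diagExt (fun κ u => (-1 : ℝ) • ghX κ u) μ y ν y') y y' (Real.exp δ) δ) ∧
    (∀ (μ : Fin 4) (y t : Site 4), ghCur μ (y + t) = shiftK (-t) (ghCur μ y)) ∧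
    (∀ (μ : Fin 4) (y : Site 4) (ν : Fin 4) (y' t : Site 4),
      diagExt (fun κ u => (-1 : ℝ) • ghX κ u) μ (y + t) ν (y' + t) = shiftK (-t) (diagExt (fun κ u => (-1 : ℝ) • ghX κ u) μ y ν y')) ∧
    (∀ y : Site 4, BiLoc ((-(1 : ℝ)) • projU y) y y 1 δ) ∧
    (∀ y : Site 4, comp (comp G0ker (divV ghCur y)) G0ker = comp G0ker ((-(1 : ℝ)) • projU y) - comp ((-(1 : ℝ)) • projU y) G0ker) ∧
    (∀ (y : Site 4) (ν : Fin 4) (y' : Site 4), divW (diagExt (fun κ u => (-1 : ℝ) • ghX κ u)) y ν y'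
      = comp ((-(1 : ℝ)) • projU y) (ghCur ν y') - comp (ghCur ν y') ((-(1 : ℝ)) • projU y)) ∧
    (∀ lam : Fin 4, ∑' p : Site 4 × Site 4, ghCur lam 0 p.1 p.2 () () = 0) ∧
    cubicGermOfSc ghCur = ghostGerm ∧
    (∀ (μ ν : Fin 4) (z : Site 4),
      BiLoc (diagExt (fun κ u => (-1 : ℝ) • ghX κ u) μ 0 ν z) 0 z (Real.exp δ * Real.exp (-δ * l1 z)) δ) := by
  refine ⟨fun μ y => biLoc_ghCur μ y δ, fun μ y ν y' => ?_, fun μ y t => ghCur_translate μ y t, hcovw_ghX (-1), fun y => hXg_projU y δ,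
    w1_ghCur, hW2g_ghX, tsum_ghCur_eq_zero, cubicGermOfSc_ghCur, fun μ ν z => ?_⟩
  · have h := hw_ghX (-1) δ μ y ν y'
    rwa [abs_neg, abs_one, one_mul] at h
  · have h := hwloc_ghX (-1) δ μ ν z
    rwa [abs_neg, abs_one, one_mul] at h

end Summit.QuantumFields.BalabanUV.Beta.FP.GhostBiTableLaw

end
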